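import Literature.AlgebraicTopology.SingularHomology.CohomologyMayerVietorisExtend
import Literature.AlgebraicTopology.SingularHomology.CohomologyOfPoint
import Literature.AlgebraicTopology.SingularHomology.SteenrodSquares
import HarnessLib

/-!
# Cohomology and Steenrod squares over a clopen decomposition

Elementary consequences of the Mayer–Vietoris sequence in singular cohomology
(A. Hatcher, *Algebraic Topology* (2002), §3.1 pp. 203–204; the tree's
`singularCohomology.eq_zero_of_map_subsetIncl_eq_zero` and
`singularCohomology.exists_map_subsetIncl_eq_of_isZero`) for a space `Y = A ⊔ B` split into two
disjoint open (hence clopen) pieces, where the overlap `A ∩ B = ∅` has no cohomology at all,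
together with the transport of the vanishing of Steenrod's square `Sq` into a given
degree (naturality, `steenrodSqLower_map`; N. Steenrod, Ann. of Math. 48 (1947), §7) along
homeomorphisms, onto clopen pieces and back from a clopen cover:

* `isZero_singularCohomology_of_isEmpty` — the empty space has no cohomology (no simplices);
* `map_subsetIncl_injective_of_clopen` — if `Hᵖ⁺¹(↥B) = 0` then restriction
  `Hᵖ⁺¹(Y) → Hᵖ⁺¹(↥A)` is injective;
* `exists_map_subsetIncl_eq_of_clopen` — every class of `Hᵖ(↥A)` is a restriction from `Y`;
* `eq_of_ne_zero_of_injective` / `eq_of_ne_zero_of_homeomorph` — "at most one nonzero element"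
  pulls back along injective linear maps and is invariant under homeomorphisms;
* `steenrodSqLower_eq_zero_of_homeomorph`, `steenrodSqLower_eq_zero_subsetIncl_of_clopen`,
  `steenrodSqLower_eq_zero_of_clopen_cover` — `Sq = 0 : Hᵏ → Hⁿ` passes along homeomorphisms,
  to a clopen piece, and holds on `Y` as soon as it holds on both pieces (`n ≠ 0`).

Written for the evenness of the intersection form of a DISCONNECTED s-parallelizable
null-cobordism of a homotopy sphere (fact seat of
`Literature.Topology.FourManifolds.HomotopySphere.exists_mem_signatureSet_iff_eight_dvd`,
Kervaire–Milnor 1963, p. 530), where the closed model splits into the closed model of the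
component of the boundary and the closed components. Everything is proved; no named facts.

## References

* A. Hatcher, *Algebraic Topology*, CUP 2002, §3.1 pp. 199, 203–204. [HatcherAT2002]
* N. E. Steenrod, *Products of cocycles and extensions of mappings*, Ann. of Math. 48 (1947),
  §7. [Steenrod1947]
-/

noncomputable section

open CategoryTheory CategoryTheory.Limits Set Function

universe u

namespace Literature.AlgebraicTopology.SingularHomology

variable {R : Type u} [CommRing R] {Y : Type u} [TopologicalSpace Y]

/-! ### Two disjoint open pieces -/

/-- **The empty space has no cohomology**, in every degree: it has no singular simplices, so
its cochain modules are trivial. [folklore] -/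
theorem isZero_singularCohomology_of_isEmpty [IsEmpty Y] (p : ℕ) :
    IsZero (singularCohomology R R Y p) := by
  refine ShortComplex.isZero_homology_of_isZero_X₂ _ ?_
  change IsZero ((singularCochainComplex R R Y).X p)
  haveI : Subsingleton ((singularCochainComplex R R Y).X p) :=
    ⟨fun φ ψ => singularCochainComplex.ext fun σ => isEmptyElim σ⟩
  exact ModuleCat.isZero_of_subsingleton _

/-- The overlap of two disjoint pieces has no cohomology. [folklore] -/
theorem isZero_singularCohomology_inter_of_disjoint {A B : Set Y} (hAB : A ∩ B = ∅) (p : ℕ) :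
    IsZero (singularCohomology R R (↥(A ∩ B)) p) := by
  haveI : IsEmpty ↥(A ∩ B) := Set.isEmpty_coe_sort.2 hAB
  exact isZero_singularCohomology_of_isEmpty p

/-- **Restriction to a clopen piece is injective when the other piece has no cohomology**
(Mayer–Vietoris, Hatcher §3.1 pp. 203–204): `A`, `B` open, `A ∪ B = Y`, `A ∩ B = ∅`,
`Hᵖ⁺¹(↥B; R) = 0`; then `Hᵖ⁺¹(Y; R) → Hᵖ⁺¹(↥A; R)` is injective. [cite: HatcherAT2002, §3.1 pp. 203–204] -/
theorem map_subsetIncl_injective_of_clopen {A B : Set Y} (hA : IsOpen A) (hB : IsOpen B)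
    (hU : A ∪ B = univ) (hAB : A ∩ B = ∅) {p : ℕ}
    (hBZ : IsZero (singularCohomology R R (↥B) (p + 1))) :
    Injective (singularCohomology.map R R (subsetIncl A) (p + 1)) := by
  refine (injective_iff_map_eq_zero _).2 fun c hc => ?_
  exact singularCohomology.eq_zero_of_map_subsetIncl_eq_zero R hA hB hU
    (isZero_singularCohomology_inter_of_disjoint hAB p) c hc (ModuleCat.eq_zero_of_isZero_obj hBZ _)

/-- **Classes on a clopen piece extend** (Mayer–Vietoris, Hatcher §3.1 pp. 203–204): `A`, `B`
open, `A ∪ B = Y`, `A ∩ B = ∅`; every class of `Hᵖ(↥A; R)` is the restriction of a class of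
`Hᵖ(Y; R)` vanishing on `B`. [cite: HatcherAT2002, §3.1 pp. 203–204] -/
theorem exists_map_subsetIncl_eq_of_clopen {A B : Set Y} (hA : IsOpen A) (hB : IsOpen B)
    (hU : A ∪ B = univ) (hAB : A ∩ B = ∅) {p : ℕ} (a : singularCohomology R R (↥A) p) :
    ∃ c : singularCohomology R R Y p, singularCohomology.map R R (subsetIncl A) p c = a ∧
      singularCohomology.map R R (subsetIncl B) p c = 0 :=
  singularCohomology.exists_map_subsetIncl_eq_of_isZero R hA hB hU
    (isZero_singularCohomology_inter_of_disjoint hAB p) a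

/-! ### "At most one nonzero element" -/

/-- "At most one nonzero element" pulls back along an injective map preserving `0`. [folklore] -/
theorem eq_of_ne_zero_of_injective {M N : Type*} [Zero M] [Zero N] (f : M → N) (hf : Injective f)
    (h0 : f 0 = 0) (hN : ∀ a b : N, a ≠ 0 → b ≠ 0 → a = b) {a b : M} (ha : a ≠ 0) (hb : b ≠ 0) :
    a = b :=
  hf (hN _ _ (fun h => ha (hf (h.trans h0.symm))) (fun h => hb (hf (h.trans h0.symm))))

/-- A homeomorphism induces an injective map on cohomology. [folklore] -/
theorem singularCohomology.map_injective_of_homeomorph {Z : Type u} [TopologicalSpace Z]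
    (e : Y ≃ₜ Z) (d : ℕ) : Injective (singularCohomology.map R R (e : C(Y, Z)) d) := by
  intro a b h
  exact ((forget (ModuleCat R)).mapIso (singularCohomology.mapIso R R e d)).toEquiv.injective h

/-- "`Hᵈ(-; R)` has at most one nonzero element" is invariant under homeomorphisms. [folklore] -/
theorem eq_of_ne_zero_of_homeomorph {Z : Type u} [TopologicalSpace Z] (e : Y ≃ₜ Z) {d : ℕ}
    (hY : ∀ a b : singularCohomology R R Y d, a ≠ 0 → b ≠ 0 → a = b)
    {a b : singularCohomology R R Z d} (ha : a ≠ 0) (hb : b ≠ 0) : a = b :=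
  eq_of_ne_zero_of_injective (fun z => singularCohomology.map R R (e : C(Y, Z)) d z)
    (singularCohomology.map_injective_of_homeomorph e d) (map_zero _) hY ha hb

/-! ### Transport of `Sq = 0` -/

section Sq

variable [CharP R 2]

/-- **`Sq = 0 : Hᵏ → Hⁿ` is invariant under homeomorphisms** (naturality of `Sq`,
`steenrodSqLower_map`). [cite: Steenrod1947, §7] -/
theorem steenrodSqLower_eq_zero_of_homeomorph {Z : Type u} [TopologicalSpace Z] (e : Y ≃ₜ Z)
    {k n : ℕ} (hY : ∀ y : singularCohomology R R Y k, steenrodSqLower Y k n 0 y = 0)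
    (z : singularCohomology R R Z k) : steenrodSqLower Z k n 0 z = 0 := by
  apply singularCohomology.map_injective_of_homeomorph e n
  rw [map_zero, steenrodSqLower_map]
  exact hY _

/-- **`Sq = 0 : Hᵏ → Hⁿ` restricts to a clopen piece**: `A`, `B` open, `A ∪ B = Y`,
`A ∩ B = ∅`; if `Sq` vanishes on `Hᵏ(Y)` it vanishes on `Hᵏ(↥A)`, every class there being a
restriction (`exists_map_subsetIncl_eq_of_clopen`) and `Sq` natural. [cite: HatcherAT2002, §3.1 pp. 203–204] [cite: Steenrod1947, §7] -/
theorem steenrodSqLower_eq_zero_subsetIncl_of_clopen {A B : Set Y} (hA : IsOpen A)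
    (hB : IsOpen B) (hU : A ∪ B = univ) (hAB : A ∩ B = ∅) {k n : ℕ}
    (hY : ∀ y : singularCohomology R R Y k, steenrodSqLower Y k n 0 y = 0)
    (a : singularCohomology R R (↥A) k) : steenrodSqLower (↥A) k n 0 a = 0 := by
  obtain ⟨c, rfl, -⟩ := exists_map_subsetIncl_eq_of_clopen hA hB hU hAB a
  rw [← steenrodSqLower_map, hY, map_zero]

/-- **`Sq = 0 : Hᵏ → Hⁿ` from a clopen cover** (`n ≠ 0`): `A`, `B` open, `A ∪ B = Y`,
`A ∩ B = ∅`; if `Sq` vanishes on `Hᵏ(↥A)` and on `Hᵏ(↥B)` then it vanishes on `Hᵏ(Y)` — the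
restrictions of `Sq y` vanish by naturality, and restriction to the two pieces is jointly
injective (`singularCohomology.eq_zero_of_map_subsetIncl_eq_zero`). [cite: HatcherAT2002, §3.1 pp. 203–204] [cite: Steenrod1947, §7] -/
theorem steenrodSqLower_eq_zero_of_clopen_cover {A B : Set Y} (hA : IsOpen A) (hB : IsOpen B)
    (hU : A ∪ B = univ) (hAB : A ∩ B = ∅) {k n : ℕ} (hn : n ≠ 0)
    (hSA : ∀ a : singularCohomology R R (↥A) k, steenrodSqLower (↥A) k n 0 a = 0)
    (hSB : ∀ b : singularCohomology R R (↥B) k, steenrodSqLower (↥B) k n 0 b = 0)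
    (y : singularCohomology R R Y k) : steenrodSqLower Y k n 0 y = 0 := by
  obtain ⟨p, rfl⟩ := Nat.exists_eq_add_one_of_ne_zero hn
  refine singularCohomology.eq_zero_of_map_subsetIncl_eq_zero R hA hB hU
    (isZero_singularCohomology_inter_of_disjoint hAB p) _ ?_ ?_
  · rw [steenrodSqLower_map]; exact hSA _
  · rw [steenrodSqLower_map]; exact hSB _

end Sq

end Literature.AlgebraicTopology.SingularHomology
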